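import Mathlib.LinearAlgebra.Matrix.NonsingularInverse
import Mathlib.LinearAlgebra.Matrix.Adjugate
import Mathlib.LinearAlgebra.Dual.Lemmas
import Mathlib.LinearAlgebra.FiniteDimensional.Lemmas
import Mathlib.LinearAlgebra.Dimension.OrzechProperty
import Literature.FieldTheory.Kummer.ConstantsValuation
import HarnessLib

/-!
# Bounded denominators for radicals of monomials (Kummer theory over function fields)

Let `L ⊇ K` be a finitely generated field extension of characteristic `0` with `K` relatively
algebraically closed in `L` (e.g. `K` algebraically closed), and let `a₁, …, a_N ∈ Lˣ` be
multiplicatively independent modulo `Kˣ`. Then the radicals of monomials in the `aᵢ` that lie in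
`L` have **bounded denominators**: there is `m₀ ≥ 1` such that whenever `xᵐ = ∏ aᵢ^{vᵢ}` with
`x ∈ L`, `m ∣ m₀ vᵢ` for all `i` — equivalently the group
`{v/m ∈ ℚᴺ : (∏ aᵢ^{vᵢ})^{1/m} ∈ L}` has finite index over `ℤᴺ`, i.e. the image of the Kummer map
of `a` has finite index in `Ẑᴺ` (Bays–Kirby 2018, Prop. 3.24, case of the torus `𝔾ₘᴺ` over an
algebraically closed field `D = H(L)` — here slightly more generally over a relatively algebraically
closed base; cf. Zilber, covers of the multiplicative group; Bays–Gavrilovich–Hils).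

Proof (valuation-theoretic): by `ConstantsValuation.lean` every `z ∈ L` transcendental over `K`
has a discrete valuation trivial on `Kˣ` with `v(z) ≠ 1`. The vectors
`(ord_v a₁, …, ord_v a_N) ∈ ℤᴺ` (`ord_v = WithZero.log ∘ v`), `v` ranging over the `K`-trivial
discrete valuations, span `ℚᴺ`
(a non-zero integer vector `w` orthogonal to all of them would give a monomial `z = ∏ aᵢ^{wᵢ}`,
transcendental over `K` by independence and relative algebraic closedness, with `ord_v z = 0`
for all `v`); choosing `N` of them with invertible matrix `M = (ord_{vᵢ} aⱼ)`, an equation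
`xᵐ = ∏ aⱼ^{vⱼ}` gives `M v = m · (ord_{vᵢ} x)ᵢ`, whence `det(M) v ∈ m ℤᴺ` by the adjugate.

* `Literature.FieldTheory.Kummer.RadicalDenominators.exists_denominator_bound`.

## References

* M. Bays, J. Kirby, *Pseudo-exponential maps, variants, and quasiminimality*, Algebra & Number
  Theory 12 (2018), Prop. 3.24.
* S. Lang, *Algebra*, GTM 211, XII §4.
-/

noncomputable section

namespace Literature.FieldTheory.Kummer

namespace RadicalDenominators

universe u

variable {L : Type u} [Field L]

/-! ### The order of a unit at a `ℤₘ₀`-valued valuation (`WithZero.log`) -/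

/-- The order `ord_v x ∈ ℤ` of a unit `x` at a `ℤₘ₀`-valued valuation `v`: Mathlib's
`WithZero.log` of `v x` (so `v x = WithZero.exp (ord_v x)` as `v x ≠ 0`). [folklore] -/
abbrev ord (v : Valuation L (WithZero (Multiplicative ℤ))) (x : Lˣ) : ℤ :=
  WithZero.log (v (x : L))

/-- A valuation does not vanish on units. [folklore] -/
theorem valuation_units_ne_zero (v : Valuation L (WithZero (Multiplicative ℤ))) (x : Lˣ) :
    v (x : L) ≠ 0 :=
  (Valuation.ne_zero_iff v).2 x.ne_zero

/-- `ord` is additive (`WithZero.log_mul`). [folklore] -/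
theorem ord_mul (v : Valuation L (WithZero (Multiplicative ℤ))) (x y : Lˣ) :
    ord v (x * y) = ord v x + ord v y := by
  rw [ord, Units.val_mul, map_mul,
    WithZero.log_mul (valuation_units_ne_zero v x) (valuation_units_ne_zero v y)]

/-- `ord` of an integer power (`WithZero.log_zpow`). [folklore] -/
theorem ord_zpow (v : Valuation L (WithZero (Multiplicative ℤ))) (x : Lˣ) (n : ℤ) :
    ord v (x ^ n) = n * ord v x := by
  rw [ord, Units.val_zpow_eq_zpow_val, map_zpow₀, WithZero.log_zpow, smul_eq_mul]

/-- `ord` of a natural power (`WithZero.log_pow`). [folklore] -/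
theorem ord_pow (v : Valuation L (WithZero (Multiplicative ℤ))) (x : Lˣ) (n : ℕ) :
    ord v (x ^ n) = n * ord v x := by
  rw [← zpow_natCast, ord_zpow]

/-- `ord` of a Laurent monomial. [folklore] -/
theorem ord_prod_zpow (v : Valuation L (WithZero (Multiplicative ℤ))) {N : ℕ} (a : Fin N → Lˣ)
    (w : Fin N → ℤ) : ord v (∏ i, a i ^ w i) = ∑ i, w i * ord v (a i) := by
  induction N with
  | zero => simp [ord]
  | succ N ih =>
    rw [Fin.prod_univ_castSucc, Fin.sum_univ_castSucc, ord_mul, ord_zpow, ih]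

/-- `ord_v x = 0 ↔ v x = 1` (`WithZero.exp_log`). [folklore] -/
theorem ord_eq_zero_iff (v : Valuation L (WithZero (Multiplicative ℤ))) (x : Lˣ) :
    ord v x = 0 ↔ v (x : L) = 1 := by
  constructor
  · intro h
    rw [← WithZero.exp_log (valuation_units_ne_zero v x), show WithZero.log (v (x : L)) = 0 from h,
      WithZero.exp_zero]
  · intro h
    rw [ord, h, WithZero.log_one]

/-! ### The spanning lemma and the denominator bound -/

variable {K : Type u} [Field K] [Algebra K L] [CharZero K]

/-- The `K`-trivial `ℤₘ₀`-valuations of `L`. [folklore] -/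
def KTrivVal (K L : Type u) [Field K] [Field L] [Algebra K L] : Type u :=
  {v : Valuation L (WithZero (Multiplicative ℤ)) // ∀ x : K, x ≠ 0 → v (algebraMap K L x) = 1}

/-- The vector of orders of `a₁, …, a_N` at a valuation, in `ℚᴺ`. [folklore] -/
def ordVec {N : ℕ} (a : Fin N → Lˣ) (v : KTrivVal K L) : Fin N → ℚ :=
  fun j => (ord v.1 (a j) : ℚ)

/-- **Spanning lemma**: if `a₁, …, a_N ∈ Lˣ` are multiplicatively independent modulo `Kˣ`, `K`
is relatively algebraically closed in the finitely generated extension `L`, then the order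
vectors `(ord_v aⱼ)ⱼ`, `v` a `K`-trivial discrete valuation, span `ℚᴺ`.
[cite: BaysKirby2018ANT, Prop. 3.24 (proof idea: Kummer theory over function fields)] -/
theorem span_ordVec_eq_top (hfg : ∃ s : Finset L, IntermediateField.adjoin K (s : Set L) = ⊤)
    (hK : ∀ z : L, IsAlgebraic K z → z ∈ Set.range (algebraMap K L))
    {N : ℕ} (a : Fin N → Lˣ)
    (hind : ∀ w : Fin N → ℤ, ((∏ i, a i ^ w i : Lˣ) : L) ∈ Set.range (algebraMap K L) → w = 0) :
    Submodule.span ℚ (Set.range (ordVec (K := K) a)) = ⊤ := by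
  classical
  by_contra hne
  have hlt : Submodule.span ℚ (Set.range (ordVec (K := K) a)) < ⊤ := lt_top_iff_ne_top.2 hne
  obtain ⟨f, hf0, hf⟩ := Submodule.exists_dual_map_eq_bot_of_lt_top hlt inferInstance
  -- `f` vanishes on all order vectors
  have hfv : ∀ v : KTrivVal K L, f (ordVec a v) = 0 := fun v => by
    have : f (ordVec a v) ∈ (Submodule.span ℚ (Set.range (ordVec (K := K) a))).map f :=
      Submodule.mem_map_of_mem (Submodule.subset_span ⟨v, rfl⟩)
    rw [hf] at this
    exact (Submodule.mem_bot ℚ).1 this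
  -- `f x = ∑ x j * w j`
  set w : Fin N → ℚ := fun j => f (Pi.single j 1) with hw
  have hfx : ∀ x : Fin N → ℚ, f x = ∑ j, x j * w j := fun x => by
    rw [LinearMap.pi_apply_eq_sum_univ f x]
    refine Finset.sum_congr rfl fun j _ => ?_
    rw [smul_eq_mul]
    congr 2
    funext i
    simp [Pi.single_apply, eq_comm]
  have hw0 : w ≠ 0 := by
    intro h
    apply hf0
    refine LinearMap.ext fun x => ?_
    rw [hfx x, h]
    simp
  -- clear denominators: `D w` is integral
  set D : ℕ := ∏ j, (w j).den with hD
  have hD0 : (D : ℚ) ≠ 0 := by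
    rw [hD]; push_cast
    exact Finset.prod_ne_zero_iff.2 fun j _ => by exact_mod_cast (w j).den_nz
  have hint : ∀ j, ∃ z : ℤ, (D : ℚ) * w j = z := fun j => by
    have hdvd : (w j).den ∣ D := Finset.dvd_prod_of_mem _ (Finset.mem_univ j)
    obtain ⟨c, hc⟩ := hdvd
    refine ⟨c * (w j).num, ?_⟩
    rw [hc]
    push_cast
    have := Rat.num_div_den (w j)
    rw [div_eq_iff (by exact_mod_cast (w j).den_nz)] at this
    -- `w j * den = num`
    calc ((w j).den : ℚ) * c * w j = c * (w j * (w j).den) := by ring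
      _ = c * (w j).num := by rw [this]
  choose w' hw' using hint
  have hw'0 : w' ≠ 0 := by
    intro h
    apply hw0
    funext j
    have := hw' j
    rw [h, Pi.zero_apply, Int.cast_zero, mul_eq_zero] at this
    exact this.resolve_left hD0
  -- the monomial `z = ∏ aⱼ ^ w'ⱼ` is transcendental over `K`
  set z : Lˣ := ∏ j, a j ^ w' j with hz
  have hztr : Transcendental K (z : L) := fun halg => hw'0 (hind w' (hK _ halg))
  obtain ⟨v, hvK, hvz, -⟩ := ConstantsValuation.exists_valuation_lt_one_of_transcendental hfg hztr
  -- but `ord_v z = D · f (ordVec a v) = 0`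
  have hord : (ord v z : ℚ) = D * f (ordVec (K := K) a ⟨v, hvK⟩) := by
    rw [hz, ord_prod_zpow, hfx]
    push_cast
    rw [Finset.mul_sum]
    refine Finset.sum_congr rfl fun j _ => ?_
    rw [← hw' j, ordVec]
    ring
  rw [hfv ⟨v, hvK⟩, mul_zero, Int.cast_eq_zero, ord_eq_zero_iff] at hord
  exact (ne_of_lt hvz) hord

/-- **Bounded denominators for radicals of monomials** (Bays–Kirby 2018, Prop. 3.24, torus case
over a relatively algebraically closed base — the image of the Kummer map has finite index):
for `L ⊇ K` finitely generated of characteristic `0` with `K` relatively algebraically closed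
in `L`, and `a₁, …, a_N ∈ Lˣ` multiplicatively independent modulo `Kˣ`, there is `m₀ ≥ 1` such
that `xᵐ = ∏ aᵢ^{vᵢ}` (`x ∈ L`, `m ∈ ℕ`, `v ∈ ℤᴺ`) implies `m ∣ m₀ vᵢ` for all `i`.
[cite: BaysKirby2018ANT, Prop. 3.24] -/
theorem exists_denominator_bound (hfg : ∃ s : Finset L, IntermediateField.adjoin K (s : Set L) = ⊤)
    (hK : ∀ z : L, IsAlgebraic K z → z ∈ Set.range (algebraMap K L))
    {N : ℕ} (a : Fin N → Lˣ)
    (hind : ∀ w : Fin N → ℤ, ((∏ i, a i ^ w i : Lˣ) : L) ∈ Set.range (algebraMap K L) → w = 0) :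
    ∃ m₀ : ℕ, 0 < m₀ ∧ ∀ (m : ℕ) (v : Fin N → ℤ) (x : Lˣ),
      x ^ m = ∏ i, a i ^ v i → ∀ i, (m : ℤ) ∣ m₀ * v i := by
  classical
  have hspan := span_ordVec_eq_top hfg hK a hind
  -- a basis of `ℚᴺ` among the order vectors
  obtain ⟨b, hbsub, hbspan, hbli⟩ := exists_linearIndependent ℚ (Set.range (ordVec (K := K) a))
  rw [hspan] at hbspan
  have hbfin : b.Finite := hbli.setFinite
  haveI : Fintype b := hbfin.fintype
  have hcard : Fintype.card b = N := by
    have h1 := linearIndependent_iff_card_eq_finrank_span.1 hbli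
    rw [Set.finrank, Subtype.range_coe_subtype, Set.setOf_mem_eq, hbspan, finrank_top,
      Module.finrank_fintype_fun_eq_card, Fintype.card_fin] at h1
    exact h1
  let e : b ≃ Fin N := Fintype.equivFinOfCardEq hcard
  -- valuations realising the basis vectors
  have hval : ∀ x : b, ∃ v : KTrivVal K L, ordVec a v = x := fun x => hbsub x.2
  choose val hval using hval
  -- the integer matrix `M i j = ord_{vᵢ} aⱼ`
  set M : Matrix (Fin N) (Fin N) ℤ := fun i j => ord (val (e.symm i)).1 (a j) with hM
  have hMQ : (M.map (Int.cast : ℤ → ℚ)) = fun i => ((e.symm i : b) : Fin N → ℚ) := by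
    funext i j
    rw [Matrix.map_apply, ← hval (e.symm i)]
    rfl
  have hli : LinearIndependent ℚ (M.map (Int.cast : ℤ → ℚ)).row := by
    change LinearIndependent ℚ fun i => (M.map (Int.cast : ℤ → ℚ)) i
    rw [hMQ]
    exact hbli.comp _ e.symm.injective
  have hunit : IsUnit (M.map (Int.cast : ℤ → ℚ)) := Matrix.linearIndependent_rows_iff_isUnit.1 hli
  have hdet : M.det ≠ 0 := by
    intro h
    have h2 : (M.map (Int.cast : ℤ → ℚ)).det = 0 := by
      change ((Int.castRingHom ℚ).mapMatrix M).det = 0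
      rw [← RingHom.map_det, h, map_zero]
    exact (Matrix.isUnit_iff_isUnit_det _ |>.1 hunit).ne_zero h2
  refine ⟨M.det.natAbs, Int.natAbs_pos.2 hdet, fun m v x hx i => ?_⟩
  -- apply the valuations: `M v = m · (ord_{vᵢ} x)ᵢ`
  have hMv : M.mulVec v = fun i => (m : ℤ) * ord (val (e.symm i)).1 x := by
    funext i
    have := congrArg (ord (val (e.symm i)).1) hx
    rw [ord_pow, ord_prod_zpow] at this
    rw [this]
    change (∑ j, M i j * v j) = ∑ j, v j * ord (val (e.symm i)).1 (a j)
    refine Finset.sum_congr rfl fun j _ => ?_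
    rw [show M i j = ord (val (e.symm i)).1 (a j) from rfl, mul_comm]
  -- adjugate: `det M • v = adj M (M v) ∈ m ℤᴺ`
  have hadj : M.det • v = M.adjugate.mulVec (M.mulVec v) := by
    rw [Matrix.mulVec_mulVec, Matrix.adjugate_mul, Matrix.smul_mulVec, Matrix.one_mulVec]
  have hi := congrFun hadj i
  rw [hMv] at hi
  simp only [Pi.smul_apply, smul_eq_mul, Matrix.mulVec, dotProduct] at hi
  -- `det M * v i = ∑ adj i j * (m * ord x) = m * (...)`
  have hdvd : (m : ℤ) ∣ M.det * v i := by
    rw [hi]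
    refine Finset.dvd_sum fun j _ => ?_
    exact Dvd.intro (M.adjugate i j * ord (val (e.symm j)).1 x) (by ring)
  -- `natAbs`
  rcases Int.natAbs_eq M.det with h | h
  · rw [← h]; exact hdvd
  · rw [show (M.det.natAbs : ℤ) = -M.det by omega, neg_mul]
    exact (dvd_neg).2 hdvd

end RadicalDenominators

end Literature.FieldTheory.Kummer
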